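import Literature.Analysis.FluidPDE.NewtonKernel
import Literature.Analysis.FluidPDE.SwirlMaximumPrinciple
import Mathlib.Analysis.Calculus.Deriv.Slope
import HarnessLib

/-!
# Lei–Zhang 2011, §2: the refined cut-off functions of the energy method

Analysis/FluidPDE proofs file (theorems only), on the discharge path of the named fact
`Literature.Analysis.FluidPDE.LeiZhang2011_liouville` (Z. Lei, Q. S. Zhang, J. Funct. Anal. 261
(2011) = arXiv:1011.5066, Theorem 1.2 via Theorem 1.1, §2 (2.1)). The paper's cut-off
`ψ(y,s) = φ(|y|) η(s)`, `supp φ ⊂ B(σ₁)`, `φ = 1` on `B(σ₂)`, `0 ≤ φ ≤ 1`,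
`supp η ⊂ (−σ₁², 0]`, `η = 1` on `(−σ₂², 0]`, `|η'| ≲ (σ₁ − σ₂)^{-2}`, `|∇φ| ≲ (σ₁ − σ₂)^{-1}`
(2.1), realised with the tree's radial cut-off `radialCutoff ρ₂ ρ₁` and `Real.smoothTransition`:

* `exists_abs_deriv_smoothTransition_le`, `deriv_smoothTransition_nonneg` — the profile;
* `radialCutoff_axisymmetric`, `radialCutoff_mul_fderiv_eR_nonpos` (radially non-increasing:
  `φ ∂ᵣφ ≤ 0`, so the axis term of the energy identity has a sign),
  `tsupport_radialCutoff_subset_closedBall`, `exists_norm_gradient_radialCutoff_le`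
  (`‖∇φ‖ ≤ C/(ρ₁ − ρ₂)` with an absolute `C`);
* `timeCutoff` facts for `η(s) = smoothTransition((s + T₁)/(T₁ − T₂))`:
  smooth, `η(−T₁) = 0`, `η = 1` on `[−T₂, ∞)`, `0 ≤ η ≤ 1`, `|η'| ≤ C/(T₁ − T₂)`.

## References

* Z. Lei, Q. S. Zhang, J. Funct. Anal. 261 (2011) = arXiv:1011.5066, §2 (2.1), p. 5.
  [LeiZhang2011]
-/

noncomputable section

open MeasureTheory Set Function Filter Metric
open _root_.Topology
open scoped InnerProductSpace RealInnerProductSpace NNReal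

namespace Literature.Analysis.FluidPDE

namespace LeiZhang2011

/-! ### The profile `Real.smoothTransition` -/

/-- The derivative of `Real.smoothTransition` is nonnegative (it is monotone). [folklore] -/
theorem deriv_smoothTransition_nonneg (t : ℝ) : 0 ≤ deriv Real.smoothTransition t :=
  Real.smoothTransition.monotone.deriv_nonneg

/-- The derivative of `Real.smoothTransition` is bounded: `|smoothTransition'| ≤ C_T`
(it vanishes off `[0, 1]` and is continuous). [folklore] -/
theorem exists_abs_deriv_smoothTransition_le :
    ∃ C : ℝ, 0 ≤ C ∧ ∀ t, |deriv Real.smoothTransition t| ≤ C := by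
  have hcont : Continuous (deriv Real.smoothTransition) :=
    (Real.smoothTransition.contDiff (n := 1)).continuous_deriv le_rfl
  obtain ⟨C, hC⟩ := isCompact_Icc.exists_bound_of_continuousOn (s := Icc (0 : ℝ) 1) hcont.continuousOn
  refine ⟨max C 0, le_max_right _ _, fun t => ?_⟩
  by_cases ht : t ∈ Icc (0 : ℝ) 1
  · exact ((Real.norm_eq_abs _).symm.le.trans (hC t ht)).trans (le_max_left _ _)
  · -- off `[0,1]` the function is locally constant
    have hd : deriv Real.smoothTransition t = 0 := by
      rcases not_and_or.1 (by simpa only [mem_Icc] using ht) with h0 | h1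
      · have h0' : t < 0 := not_le.1 h0
        have hev : Real.smoothTransition =ᶠ[𝓝 t] fun _ => (0 : ℝ) := by
          filter_upwards [Iio_mem_nhds h0'] with s hs
          exact Real.smoothTransition.zero_of_nonpos hs.le
        rw [hev.deriv_eq, deriv_const]
      · have h1' : 1 < t := not_le.1 h1
        have hev : Real.smoothTransition =ᶠ[𝓝 t] fun _ => (1 : ℝ) := by
          filter_upwards [Ioi_mem_nhds h1'] with s hs
          exact Real.smoothTransition.one_of_one_le hs.le
        rw [hev.deriv_eq, deriv_const]
    rw [hd, abs_zero]
    exact le_max_right _ _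

/-! ### The space cut-off `φ = radialCutoff ρ₂ ρ₁` -/

/-- A radial cut-off is axisymmetric. [folklore] -/
theorem radialCutoff_axisymmetric (ρ₂ ρ₁ : ℝ) :
    IsAxisymmetricScalar (radialCutoff ρ₂ ρ₁ : EuclideanSpace ℝ (Fin 3) → ℝ) :=
  fun θ x => radialCutoff_radial ρ₂ ρ₁ (norm_rotZ θ x)

/-- The support of `radialCutoff ρ₂ ρ₁` is contained in the closed ball of radius `ρ₁`
(`0 ≤ ρ₂ < ρ₁`). [folklore] -/
theorem tsupport_radialCutoff_subset_closedBall {ρ₂ ρ₁ : ℝ} (h₀ : 0 ≤ ρ₂) (h₁ : ρ₂ < ρ₁) :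
    tsupport (radialCutoff ρ₂ ρ₁ : EuclideanSpace ℝ (Fin 3) → ℝ) ⊆ closedBall 0 ρ₁ :=
  tsupport_radialCutoff_subset h₀ h₁

/-- The derivative of the radial cut-off:
`Dφ(z) = Θ'(c (ρ₁² − ‖z‖²)) · c · (−2⟪z, ·⟫)`, `c = (ρ₁² − ρ₂²)⁻¹`, `Θ = smoothTransition`.
[folklore] -/
theorem hasFDerivAt_radialCutoff (ρ₂ ρ₁ : ℝ) (z : EuclideanSpace ℝ (Fin 3)) :
    HasFDerivAt (radialCutoff ρ₂ ρ₁ : EuclideanSpace ℝ (Fin 3) → ℝ)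
      ((deriv Real.smoothTransition ((ρ₁ ^ 2 - ρ₂ ^ 2)⁻¹ * (ρ₁ ^ 2 - ‖z‖ ^ 2))) •
        ((ρ₁ ^ 2 - ρ₂ ^ 2)⁻¹ • (-((2 : ℝ) • innerSL ℝ z)))) z := by
  have h1 : HasFDerivAt (fun x : EuclideanSpace ℝ (Fin 3) => ‖x‖ ^ 2) ((2 : ℝ) • innerSL ℝ z) z := by
    have h := (hasStrictFDerivAt_norm_sq z).hasFDerivAt
    rw [← Nat.cast_smul_eq_nsmul ℝ] at h
    simpa only [Nat.cast_ofNat] using h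
  have ha : HasFDerivAt (fun x : EuclideanSpace ℝ (Fin 3) => (ρ₁ ^ 2 - ρ₂ ^ 2)⁻¹ * (ρ₁ ^ 2 - ‖x‖ ^ 2))
      ((ρ₁ ^ 2 - ρ₂ ^ 2)⁻¹ • (-((2 : ℝ) • innerSL ℝ z))) z :=
    (h1.const_sub (ρ₁ ^ 2)).const_mul _
  have hT : HasDerivAt Real.smoothTransition
      (deriv Real.smoothTransition ((ρ₁ ^ 2 - ρ₂ ^ 2)⁻¹ * (ρ₁ ^ 2 - ‖z‖ ^ 2)))
      ((ρ₁ ^ 2 - ρ₂ ^ 2)⁻¹ * (ρ₁ ^ 2 - ‖z‖ ^ 2)) :=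
    ((Real.smoothTransition.contDiff (n := 1)).differentiable one_ne_zero _).hasDerivAt
  have h := hT.comp_hasFDerivAt z ha
  have e : (radialCutoff ρ₂ ρ₁ : EuclideanSpace ℝ (Fin 3) → ℝ) =
      Real.smoothTransition ∘ fun x : EuclideanSpace ℝ (Fin 3) =>
        (ρ₁ ^ 2 - ρ₂ ^ 2)⁻¹ * (ρ₁ ^ 2 - ‖x‖ ^ 2) := by
    funext x
    simp only [radialCutoff, cutoffProfile, Function.comp_apply, div_eq_inv_mul]
  rw [e]
  exact h

/-- **Radial monotonicity**: `φ ∂ᵣφ ≤ 0` for `φ = radialCutoff ρ₂ ρ₁`, `ρ₂ < ρ₁`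
(`Θ' ≥ 0`, `⟪z, e_r⟫ ≥ 0`, `φ ≥ 0`): the axis term of the energy identity can be dropped.
[cite: LeiZhang2011, §2 (2.1) (arXiv p. 5), the radial cut-off] -/
theorem radialCutoff_mul_fderiv_eR_nonpos {ρ₂ ρ₁ : ℝ} (h₁ : ρ₂ < ρ₁) (h₀ : 0 ≤ ρ₂)
    (z : EuclideanSpace ℝ (Fin 3)) :
    radialCutoff ρ₂ ρ₁ z * fderiv ℝ (radialCutoff ρ₂ ρ₁ : EuclideanSpace ℝ (Fin 3) → ℝ) z (eR z) ≤ 0 := by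
  rw [(hasFDerivAt_radialCutoff ρ₂ ρ₁ z).fderiv]
  have hd : 0 < ρ₁ ^ 2 - ρ₂ ^ 2 := by nlinarith
  have h1 : 0 ≤ deriv Real.smoothTransition ((ρ₁ ^ 2 - ρ₂ ^ 2)⁻¹ * (ρ₁ ^ 2 - ‖z‖ ^ 2)) :=
    deriv_smoothTransition_nonneg _
  have h2 : 0 ≤ ⟪z, eR z⟫ := inner_self_eR_nonneg z
  have h3 : 0 ≤ radialCutoff ρ₂ ρ₁ z := radialCutoff_nonneg _ _ _
  simp only [FunLike.coe_smul, Pi.smul_apply, neg_apply, innerSL_apply_apply, smul_eq_mul]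
  have h4 : deriv Real.smoothTransition ((ρ₁ ^ 2 - ρ₂ ^ 2)⁻¹ * (ρ₁ ^ 2 - ‖z‖ ^ 2)) *
      ((ρ₁ ^ 2 - ρ₂ ^ 2)⁻¹ * -(2 * ⟪z, eR z⟫)) ≤ 0 := by
    have : 0 ≤ deriv Real.smoothTransition ((ρ₁ ^ 2 - ρ₂ ^ 2)⁻¹ * (ρ₁ ^ 2 - ‖z‖ ^ 2)) *
        ((ρ₁ ^ 2 - ρ₂ ^ 2)⁻¹ * (2 * ⟪z, eR z⟫)) := by positivity
    linarith
  exact mul_nonpos_of_nonneg_of_nonpos h3 h4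

/-- **The gradient bound of the radial cut-off**: there is an absolute `C ≥ 0` with
`‖∇ radialCutoff ρ₂ ρ₁ (z)‖ ≤ C / (ρ₁ − ρ₂)` for all `0 ≤ ρ₂ < ρ₁` and all `z`
(`|∇φ| ≲ (σ₁ − σ₂)^{-1}` of (2.1)). [cite: LeiZhang2011, §2 (2.1) (arXiv p. 5)] -/
theorem exists_norm_fderiv_radialCutoff_le :
    ∃ C : ℝ, 0 ≤ C ∧ ∀ (ρ₂ ρ₁ : ℝ), 0 ≤ ρ₂ → ρ₂ < ρ₁ → ∀ z : EuclideanSpace ℝ (Fin 3),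
      ‖fderiv ℝ (radialCutoff ρ₂ ρ₁ : EuclideanSpace ℝ (Fin 3) → ℝ) z‖ ≤ C / (ρ₁ - ρ₂) := by
  obtain ⟨CT, hCT0, hCT⟩ := exists_abs_deriv_smoothTransition_le
  refine ⟨2 * CT, by positivity, fun ρ₂ ρ₁ h₀ h₁ z => ?_⟩
  have hρ₁ : 0 < ρ₁ := lt_of_le_of_lt h₀ h₁
  have hd : 0 < ρ₁ ^ 2 - ρ₂ ^ 2 := by nlinarith
  have hsub : 0 < ρ₁ - ρ₂ := sub_pos.2 h₁
  by_cases hz : ρ₁ < ‖z‖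
  · -- outside the ball the cut-off is locally zero
    have hev := radialCutoff_eventuallyEq_zero (E := EuclideanSpace ℝ (Fin 3)) h₀ h₁ hz
    rw [hev.fderiv_eq, fderiv_const_apply, norm_zero]
    positivity
  · have hz' : ‖z‖ ≤ ρ₁ := not_lt.1 hz
    rw [(hasFDerivAt_radialCutoff ρ₂ ρ₁ z).fderiv, norm_smul, norm_smul, norm_neg, norm_smul,
      innerSL_apply_norm, Real.norm_eq_abs, Real.norm_eq_abs, abs_of_pos (inv_pos.2 hd),
      Real.norm_eq_abs, abs_two]
    calc |deriv Real.smoothTransition ((ρ₁ ^ 2 - ρ₂ ^ 2)⁻¹ * (ρ₁ ^ 2 - ‖z‖ ^ 2))| *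
          ((ρ₁ ^ 2 - ρ₂ ^ 2)⁻¹ * (2 * ‖z‖))
        ≤ CT * ((ρ₁ ^ 2 - ρ₂ ^ 2)⁻¹ * (2 * ρ₁)) := by
          gcongr
          exact hCT _
      _ = 2 * CT * (ρ₁ / ((ρ₁ - ρ₂) * (ρ₁ + ρ₂))) := by
          rw [show ρ₁ ^ 2 - ρ₂ ^ 2 = (ρ₁ - ρ₂) * (ρ₁ + ρ₂) by ring]; ring
      _ ≤ 2 * CT * (1 / (ρ₁ - ρ₂)) := by
          refine mul_le_mul_of_nonneg_left ?_ (by positivity)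
          rw [div_le_div_iff₀ (by positivity) hsub]
          nlinarith
      _ = 2 * CT / (ρ₁ - ρ₂) := by ring

/-- The gradient form of the bound: `‖∇ radialCutoff ρ₂ ρ₁ (z)‖ ≤ C/(ρ₁ − ρ₂)`. [cite: LeiZhang2011, §2 (2.1) (arXiv p. 5)] -/
theorem exists_norm_gradient_radialCutoff_le :
    ∃ C : ℝ, 0 ≤ C ∧ ∀ (ρ₂ ρ₁ : ℝ), 0 ≤ ρ₂ → ρ₂ < ρ₁ → ∀ z : EuclideanSpace ℝ (Fin 3),
      ‖gradient (radialCutoff ρ₂ ρ₁ : EuclideanSpace ℝ (Fin 3) → ℝ) z‖ ≤ C / (ρ₁ - ρ₂) := by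
  obtain ⟨C, hC0, hC⟩ := exists_norm_fderiv_radialCutoff_le
  refine ⟨C, hC0, fun ρ₂ ρ₁ h₀ h₁ z => ?_⟩
  rw [gradient, LinearIsometryEquiv.norm_map]
  exact hC ρ₂ ρ₁ h₀ h₁ z

/-! ### The time cut-off `η(s) = smoothTransition ((s + T₁)/(T₁ − T₂))` -/

/-- **The time cut-off** `η(s) = smoothTransition((s + T₁)/(T₁ − T₂))` for `T₂ < T₁`: smooth,
`η(−T₁) = 0`, `η = 1` on `[−T₂, ∞)`, `0 ≤ η ≤ 1`, and `|η'| ≤ C_T/(T₁ − T₂)` with the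
absolute constant of `exists_abs_deriv_smoothTransition_le` (the time factor of (2.1)). [cite: LeiZhang2011, §2 (2.1) (arXiv p. 5), the time cut-off] -/
theorem timeCutoff_props {T₁ T₂ : ℝ} (hT : T₂ < T₁) {CT : ℝ}
    (hCT : ∀ t, |deriv Real.smoothTransition t| ≤ CT) :
    ContDiff ℝ 1 (fun s : ℝ => Real.smoothTransition ((s + T₁) / (T₁ - T₂))) ∧
    Real.smoothTransition ((-T₁ + T₁) / (T₁ - T₂)) = 0 ∧
    (∀ s, -T₂ ≤ s → Real.smoothTransition ((s + T₁) / (T₁ - T₂)) = 1) ∧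
    (∀ s, 0 ≤ Real.smoothTransition ((s + T₁) / (T₁ - T₂)) ∧
      Real.smoothTransition ((s + T₁) / (T₁ - T₂)) ≤ 1) ∧
    (∀ s, |deriv (fun s : ℝ => Real.smoothTransition ((s + T₁) / (T₁ - T₂))) s| ≤ CT / (T₁ - T₂)) := by
  have hd : 0 < T₁ - T₂ := sub_pos.2 hT
  have haff : ∀ s, HasDerivAt (fun s : ℝ => (s + T₁) / (T₁ - T₂)) (1 / (T₁ - T₂)) s := fun s => by
    have := ((hasDerivAt_id s).add_const T₁).div_const (T₁ - T₂)
    simpa using this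
  refine ⟨?_, ?_, ?_, ?_, ?_⟩
  · exact Real.smoothTransition.contDiff.comp ((contDiff_id.add contDiff_const).div_const _)
  · simp [Real.smoothTransition.zero]
  · intro s hs
    exact Real.smoothTransition.one_of_one_le ((one_le_div hd).2 (by linarith))
  · exact fun s => ⟨Real.smoothTransition.nonneg _, Real.smoothTransition.le_one _⟩
  · intro s
    have hT' : HasDerivAt Real.smoothTransition (deriv Real.smoothTransition ((s + T₁) / (T₁ - T₂)))
        ((s + T₁) / (T₁ - T₂)) :=
      ((Real.smoothTransition.contDiff (n := 1)).differentiable one_ne_zero _).hasDerivAt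
    have h := hT'.comp s (haff s)
    have e : (fun s : ℝ => Real.smoothTransition ((s + T₁) / (T₁ - T₂))) =
        Real.smoothTransition ∘ fun s => (s + T₁) / (T₁ - T₂) := rfl
    rw [e, h.deriv, abs_mul, abs_of_pos (one_div_pos.2 hd)]
    calc |deriv Real.smoothTransition ((s + T₁) / (T₁ - T₂))| * (1 / (T₁ - T₂))
        ≤ CT * (1 / (T₁ - T₂)) := mul_le_mul_of_nonneg_right (hCT _) (by positivity)
      _ = CT / (T₁ - T₂) := by ring

end LeiZhang2011

end Literature.Analysis.FluidPDE

namespace Literature.Analysis.FluidPDE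

namespace LeiZhang2011

/-- `⟪x, e_r(x)⟫ = r(x)` (both sides vanish on the axis, where `e_r` has the junk value `0`).
[folklore] -/
theorem inner_self_eR_eq_cylRadius (x : EuclideanSpace ℝ (Fin 3)) : ⟪x, eR x⟫ = cylRadius x := by
  rw [eR, real_inner_smul_right]
  have h : ⟪x, WithLp.toLp 2 ![x 0, x 1, 0]⟫ = x 0 ^ 2 + x 1 ^ 2 := by
    simp [PiLp.inner_apply, Fin.sum_univ_three]; ring
  rw [h, ← cylRadius_sq]
  by_cases hr : cylRadius x = 0
  · simp [hr]
  · field_simp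

/-- **The axis weight of a radial cut-off is bounded** (no `1/r` singularity): for
`φ = radialCutoff ρ₂ ρ₁`, `0 ≤ ρ₂ < ρ₁`,
`|(2/r) ∂ᵣ(φ²)(x)| ≤ (8 C_T/(ρ₁² − ρ₂²)) φ(x)`
(`∂ᵣφ = −2Θ' c ⟪x, e_r⟫ = −2Θ' c r`, so `(2/r)∂ᵣ(φ²) = −8 φ Θ' c` off the axis and `0` on it).
This is the fact "the support of `(1/r)|∂ᵣζ|` is away from the `z`-axis" used for the axis terms
in the proofs of Lemmas 3.2 and 3.4 of Lei–Zhang 2011. [cite: LeiZhang2011, proof of Lemma 3.2 (arXiv p. 9), the axis term] -/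
theorem abs_axis_weight_radialCutoff_sq_le {ρ₂ ρ₁ : ℝ} (h₀ : 0 ≤ ρ₂) (h₁ : ρ₂ < ρ₁) {CT : ℝ}
    (hCT : ∀ t, |deriv Real.smoothTransition t| ≤ CT) (x : EuclideanSpace ℝ (Fin 3)) :
    |2 / cylRadius x *
        fderiv ℝ (fun y => (radialCutoff ρ₂ ρ₁ : EuclideanSpace ℝ (Fin 3) → ℝ) y ^ 2) x (eR x)| ≤
      8 * CT / (ρ₁ ^ 2 - ρ₂ ^ 2) * radialCutoff ρ₂ ρ₁ x := by
  set φ : EuclideanSpace ℝ (Fin 3) → ℝ := radialCutoff ρ₂ ρ₁ with hφ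
  have hd : 0 < ρ₁ ^ 2 - ρ₂ ^ 2 := by nlinarith
  have hφ0 : 0 ≤ φ x := radialCutoff_nonneg _ _ _
  have hCT0 : 0 ≤ CT := (abs_nonneg _).trans (hCT 0)
  have hD := hasFDerivAt_radialCutoff ρ₂ ρ₁ x
  set d : ℝ := deriv Real.smoothTransition ((ρ₁ ^ 2 - ρ₂ ^ 2)⁻¹ * (ρ₁ ^ 2 - ‖x‖ ^ 2)) with hdd
  -- `∂ᵣφ = −2 d c r`
  have h1 : fderiv ℝ φ x (eR x) = d * ((ρ₁ ^ 2 - ρ₂ ^ 2)⁻¹ * -(2 * cylRadius x)) := by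
    rw [hD.fderiv]
    simp only [FunLike.coe_smul, Pi.smul_apply, neg_apply, innerSL_apply_apply, smul_eq_mul,
      inner_self_eR_eq_cylRadius]
  -- `∂ᵣ(φ²) = 2 φ ∂ᵣφ`
  have hφd : DifferentiableAt ℝ φ x := hD.differentiableAt
  have h2 : fderiv ℝ (fun y => φ y ^ 2) x (eR x) = 2 * φ x * fderiv ℝ φ x (eR x) := by
    rw [(hφd.hasFDerivAt.pow 2).fderiv]
    simp
  rw [h2, h1]
  by_cases hr : cylRadius x = 0
  · rw [hr]; simp; positivity
  · have hrpos : 0 < cylRadius x := lt_of_le_of_ne (cylRadius_nonneg x) (Ne.symm hr)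
    have e : 2 / cylRadius x * (2 * φ x * (d * ((ρ₁ ^ 2 - ρ₂ ^ 2)⁻¹ * -(2 * cylRadius x)))) =
        -(8 * (ρ₁ ^ 2 - ρ₂ ^ 2)⁻¹ * (φ x * d)) := by
      field_simp; ring
    rw [e, abs_neg, abs_mul, abs_of_pos (by positivity : (0:ℝ) < 8 * (ρ₁ ^ 2 - ρ₂ ^ 2)⁻¹), abs_mul,
      abs_of_nonneg hφ0]
    calc 8 * (ρ₁ ^ 2 - ρ₂ ^ 2)⁻¹ * (φ x * |d|) ≤ 8 * (ρ₁ ^ 2 - ρ₂ ^ 2)⁻¹ * (φ x * CT) := by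
          gcongr; exact hCT _
      _ = 8 * CT / (ρ₁ ^ 2 - ρ₂ ^ 2) * φ x := by rw [div_eq_mul_inv]; ring

end LeiZhang2011

end Literature.Analysis.FluidPDE

namespace Literature.Analysis.FluidPDE

namespace LeiZhang2011

/-- **A two-sided time cut-off** `η(s) = Θ((s + T)/w) · Θ(−s/w)` (`Θ = smoothTransition`,
`0 < w`): `C¹`, `η(−T) = η(0) = 0`, `0 ≤ η ≤ 1`, `η = 1` on `[−T + w, −w]`, and `|η'| ≤ 2C_T/w`.
This is the time factor of the test function of Lemma 3.4 of Lei–Zhang 2011 ("`η ∈ C₀^∞` such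
that `η = 1` on `[−7/8, −1/8]` and `η` is supported in `(−1, 0)`"). [cite: LeiZhang2011, proof of Lemma 3.4 (arXiv p. 11), the cut-off ψ = φ(|x|)η(t)] -/
theorem timeCutoff₂_props {T w : ℝ} (hw : 0 < w) {CT : ℝ}
    (hCT : ∀ t, |deriv Real.smoothTransition t| ≤ CT) :
    ContDiff ℝ 1 (fun s : ℝ => Real.smoothTransition ((s + T) / w) * Real.smoothTransition (-s / w)) ∧
    Real.smoothTransition ((-T + T) / w) * Real.smoothTransition (-(-T) / w) = 0 ∧
    Real.smoothTransition ((0 + T) / w) * Real.smoothTransition (-0 / w) = 0 ∧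
    (∀ s, 0 ≤ Real.smoothTransition ((s + T) / w) * Real.smoothTransition (-s / w) ∧
      Real.smoothTransition ((s + T) / w) * Real.smoothTransition (-s / w) ≤ 1) ∧
    (∀ s, -T + w ≤ s → s ≤ -w →
      Real.smoothTransition ((s + T) / w) * Real.smoothTransition (-s / w) = 1) ∧
    (∀ s, |deriv (fun s : ℝ => Real.smoothTransition ((s + T) / w) * Real.smoothTransition (-s / w)) s| ≤
      2 * CT / w) := by
  have hCT0 : 0 ≤ CT := (abs_nonneg _).trans (hCT 0)
  have h1d : ∀ s, HasDerivAt (fun s : ℝ => (s + T) / w) (1 / w) s := fun s => by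
    simpa using ((hasDerivAt_id s).add_const T).div_const w
  have h2d : ∀ s, HasDerivAt (fun s : ℝ => -s / w) (-1 / w) s := fun s => by
    simpa using (hasDerivAt_id s).neg.div_const w
  have hTd : ∀ t, HasDerivAt Real.smoothTransition (deriv Real.smoothTransition t) t := fun t =>
    ((Real.smoothTransition.contDiff (n := 1)).differentiable one_ne_zero t).hasDerivAt
  refine ⟨?_, ?_, ?_, ?_, ?_, ?_⟩
  · exact (Real.smoothTransition.contDiff.comp ((contDiff_id.add contDiff_const).div_const _)).mul
      (Real.smoothTransition.contDiff.comp (contDiff_id.neg.div_const _))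
  · simp [Real.smoothTransition.zero]
  · simp [Real.smoothTransition.zero]
  · intro s
    exact ⟨mul_nonneg (Real.smoothTransition.nonneg _) (Real.smoothTransition.nonneg _),
      mul_le_one₀ (Real.smoothTransition.le_one _) (Real.smoothTransition.nonneg _)
        (Real.smoothTransition.le_one _)⟩
  · intro s hs1 hs2
    rw [Real.smoothTransition.one_of_one_le ((one_le_div hw).2 (by linarith)),
      Real.smoothTransition.one_of_one_le ((one_le_div hw).2 (by linarith)), mul_one]
  · intro s
    have hA := (hTd _).comp s (h1d s)
    have hB := (hTd _).comp s (h2d s)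
    have h := hA.mul hB
    have e : (fun s : ℝ => Real.smoothTransition ((s + T) / w) * Real.smoothTransition (-s / w)) =
        (Real.smoothTransition ∘ fun s => (s + T) / w) * (Real.smoothTransition ∘ fun s => -s / w) := rfl
    rw [e, h.deriv]
    have hθ1 : |Real.smoothTransition ((s + T) / w)| ≤ 1 := by
      rw [abs_of_nonneg (Real.smoothTransition.nonneg _)]; exact Real.smoothTransition.le_one _
    have hθ2 : |Real.smoothTransition (-s / w)| ≤ 1 := by
      rw [abs_of_nonneg (Real.smoothTransition.nonneg _)]; exact Real.smoothTransition.le_one _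
    simp only [Function.comp_apply]
    calc |deriv Real.smoothTransition ((s + T) / w) * (1 / w) * Real.smoothTransition (-s / w) +
          Real.smoothTransition ((s + T) / w) * (deriv Real.smoothTransition (-s / w) * (-1 / w))|
        ≤ |deriv Real.smoothTransition ((s + T) / w) * (1 / w) * Real.smoothTransition (-s / w)| +
          |Real.smoothTransition ((s + T) / w) * (deriv Real.smoothTransition (-s / w) * (-1 / w))| :=
          abs_add_le _ _
      _ ≤ CT * (1 / w) * 1 + 1 * (CT * (1 / w)) := by
          rw [abs_mul, abs_mul, abs_mul, abs_mul, abs_of_pos (one_div_pos.2 hw),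
            show |(-1 : ℝ) / w| = 1 / w by rw [abs_div, abs_neg, abs_one, abs_of_pos hw]]
          gcongr
          · exact hCT _
          · exact hCT _
      _ = 2 * CT / w := by ring

end LeiZhang2011

end Literature.Analysis.FluidPDE
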